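import Literature.NumberTheory.LFunctions.TaoLogElliottReduction
import Mathlib.NumberTheory.Harmonic.Bounds
import HarnessLib

/-!
# Tao's log-averaged Elliott theorem: the printed steps of the §2 reduction

Third layer of the proof DAG below the named fact `Literature.NumberTheory.LFunctions.tao_log_averaged_elliott_two`
(Tao, Forum Math. Pi 4 (2016) e8, Theorem 1.3).  `TaoLogElliottReduction.lean` records the whole
of §2 of the paper as ONE named fact `Literature.NumberTheory.LFunctions.Tao2016_section2_reduction`
(`Tao2016_theorem23 → tao_log_averaged_elliott_two`).  Here that reduction is split into its
printed steps, each stated as the implication the paper proves between restricted forms of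
Theorem 1.3, and the two elementary steps are PROVED:

* `Literature.Tao2016_theorem13For P₁ P₂` — Theorem 1.3 restricted to `g₁ ∈ P₁`, `g₂ ∈ P₂`
  (`tao_log_averaged_elliott_two_iff : tao_log_averaged_elliott_two ↔ Tao2016_theorem13For ⊤ ⊤`);
  the classes used are `Literature.NumberTheory.LFunctions.IsCircleValued` (`|g(n)| = 1`, `n ≥ 1`) and
  `Literature.NumberTheory.LFunctions.IsCircleValuedCM` (moreover completely multiplicative, `Literature.NumberTheory.LFunctions.IsCompletelyMultiplicative`).
* `Literature.NumberTheory.LFunctions.Tao2016_prop21` — NAMED FACT (Prop. 2.1 as printed): the case `|g₁| = 1` suffices.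
* `Literature.NumberTheory.LFunctions.Tao2016_prop21_right` — NAMED FACT (sentence after Prop. 2.1): the case `|g₁| = |g₂| = 1`
  suffices for the case `|g₁| = 1`.
* `Literature.NumberTheory.LFunctions.Tao2016_prop22` — NAMED FACT (Prop. 2.2, as proved there): the case (`g₁` completely
  multiplicative, `|g₁| = |g₂| = 1`) suffices for the case `|g₁| = |g₂| = 1`.
* `Literature.NumberTheory.LFunctions.Tao2016_prop22_right` — NAMED FACT (sentence after Prop. 2.2): the case (`g₁, g₂`
  completely multiplicative and `S¹`-valued) suffices for the previous one.
* `Literature.NumberTheory.LFunctions.Tao2016_theorem13For_cm_of_theorem23` — PROVED (the two paragraphs before Thm 2.3): the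
  rescaling `(a₁, a₂, b₁, b₂) ↦ (a₁a₂, a₁a₂, a₂b₁, a₁b₂)` for completely multiplicative
  `S¹`-valued `g₁, g₂` and the strengthening of `ω ≤ x` to `ω ≤ x / log x`, i.e.
  `Tao2016_theorem23 → Tao2016_theorem13For IsCircleValuedCM IsCircleValuedCM`.
* `Literature.NumberTheory.LFunctions.Tao2016_section2_reduction_of_props` — PROVED assembly:
  `prop21 → prop21_right → prop22 → prop22_right → Tao2016_section2_reduction`, whence
  `Literature.NumberTheory.LFunctions.tao_log_averaged_elliott_two_of_props`.

Remaining DAG for the discharge of `tao_log_averaged_elliott_two` (paper numbering):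
`Tao2016_prop21`, `_prop21_right` ⇐ Halász's inequality (`Literature.NumberTheory.Sieve.halaszMontgomeryTenenbaum`)
+ Mertens' second theorem + a random `±1` completely-split model of `|g|` (Markov);
`Tao2016_prop22`, `_prop22_right` ⇐ elementary (twisted Möbius inversion `g = g̃ * h`, harmonic
sums over `d ∣ a₁n + b₁`, `∑_d |h(d)| d^{-2/3} < ∞`);
`Tao2016_theorem23` ⇐ Prop. 2.4 (Matomäki–Radziwiłł–Tao 2015, Thm 1.7) + Lemma 2.5 + Prop. 2.6 +
Lemmas 3.2 (entropy decrement), 3.3, 3.5 (Hoeffding), 3.6 (circle method), 3.7 (Green–Tao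
restriction estimate for prime exponential sums).

## References
* T. Tao, *The logarithmically averaged Chowla and Elliott conjectures for two-point
  correlations*, Forum Math. Pi 4 (2016), e8; arXiv:1509.05422, §2: Propositions 2.1, 2.2, the
  sentences following their proofs, and the two paragraphs preceding Theorem 2.3.

## Design choices
* The restricted forms of Theorem 1.3 keep the exact binder structure of
  `Literature.NumberTheory.LFunctions.tao_log_averaged_elliott_two` (arithmetic functions, `IsMultiplicative`, `1`-boundedness,
  hypothesis (1.5) at level `A` and height `x`, conclusion `≤ ε log ω`), with two extra class
  hypotheses `P₁ g₁`, `P₂ g₂`; so `P₁ = P₂ = ⊤` is Theorem 1.3 by `Iff` of definitional unfolding.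
* Prop. 2.2 is printed as "it suffices [for Theorem 1.3] to treat the completely multiplicative
  unimodular case", its proof starting from the unimodular case supplied by Prop. 2.1; we record
  the implication actually proved (unimodular-CM case ⇒ unimodular case), which composes with
  Prop. 2.1 to the printed assertion (`Tao2016_section2_reduction_of_props`).
* In the proved step, Theorem 2.3 (vendored with integer `b, h` and `Int.toNat` arguments) is
  invoked with `a = a₁a₂`, `b = a₂b₁`, `h = a₁b₂ - a₂b₁ ≠ 0`, tolerance `ε/2` and level
  `√A / 2` (which is `≤ x / log x` because `x ≥ A`), for `A ≥ max (4A₁² + 4, exp((8/ε)² + 1))`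
  where `A₁` is the threshold of Theorem 2.3; the discarded terms `n ≤ log x` are bounded by the
  harmonic estimate `∑_{n ≤ y} 1/n ≤ 1 + log y` (`harmonic_floor_le_one_add_log`).
-/

open Finset Complex

namespace Literature.NumberTheory.LFunctions

/-! ### Notation -/

/-- Tao's non-pretentiousness hypothesis for `g` at level `A` and height `x` (Tao 2016, (1.5),
repeated as (2.2)): `∑_{p ≤ x} (1 - Re g(p) χ̄(p) p^{-it}) / p ≥ A` — i.e.
`𝔻(g, χ(n) n^{it}; x)² ≥ A` (`Literature.NumberTheory.Sieve.pretentiousDistSq`, `Literature.NumberTheory.Sieve.twistedChar`) — for every Dirichlet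
character `χ` of period `1 ≤ q ≤ A` and every real `t` with `|t| ≤ A x`.  This is, verbatim, the
hypothesis of `Literature.NumberTheory.LFunctions.tao_log_averaged_elliott_two` and of `Literature.NumberTheory.LFunctions.Tao2016_theorem23`.
[cite: TaoFMP2016, (1.5) and (2.2)] -/
def Tao2016_nonpretentiousAt (g : ℕ → ℂ) (A x : ℝ) : Prop :=
  ∀ (q : ℕ) (χ : DirichletCharacter ℂ q) (t : ℝ), 1 ≤ q → (q : ℝ) ≤ A → |t| ≤ A * x →
    A ≤ Sieve.pretentiousDistSq g (Sieve.twistedChar χ t) x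

/-- The logarithmically averaged two-point correlation
`∑_{x/ω < n ≤ x} g₁(a₁ n + b₁) g₂(a₂ n + b₂) / n` of Tao 2016, (1.6) (natural-number shifts, the
range `x/ω < n ≤ x` of integers being `Finset.Ioc ⌊x/ω⌋₊ ⌊x⌋₊`, as in
`Literature.NumberTheory.LFunctions.tao_log_averaged_elliott_two`). [cite: TaoFMP2016, (1.6)] -/
noncomputable def logCorrelation (g₁ g₂ : ℕ → ℂ) (a₁ b₁ a₂ b₂ : ℕ) (x ω : ℝ) : ℂ :=
  ∑ n ∈ Ioc ⌊x / ω⌋₊ ⌊x⌋₊, g₁ (a₁ * n + b₁) * g₂ (a₂ * n + b₂) / (n : ℂ)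

/-- `g` takes values in the unit circle `S¹` on the positive integers: `|g(n)| = 1` for all
`n ≥ 1` (Tao 2016, Prop. 2.1: "the special case where `|g₁(n)| = 1` for all `n`"; an arithmetic
function has `g 0 = 0`, and `0 ∉ ℕ = {1, 2, …}` in the paper). [cite: TaoFMP2016, Proposition 2.1] -/
def IsCircleValued (g : ArithmeticFunction ℂ) : Prop :=
  ∀ n : ℕ, n ≠ 0 → ‖g n‖ = 1

/-- `g` is completely multiplicative: `g(mn) = g(m) g(n)` for all `m, n` (Tao 2016, Prop. 2.2;
for an arithmetic function, `g 0 = 0`, this is the same as asking it for `m, n ≥ 1`; together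
with `ArithmeticFunction.IsMultiplicative`, which supplies `g 1 = 1`). [cite: TaoFMP2016, Proposition 2.2] -/
def IsCompletelyMultiplicative (g : ArithmeticFunction ℂ) : Prop :=
  ∀ m n : ℕ, g (m * n) = g m * g n

/-- **Tao 2016, Theorem 1.3 restricted to classes `P₁ ∋ g₁`, `P₂ ∋ g₂`.**  For
`P₁ = P₂ = ⊤` this is `Literature.NumberTheory.LFunctions.tao_log_averaged_elliott_two` verbatim
(`tao_log_averaged_elliott_two_iff`); §2 of the paper proves Theorem 1.3 by successively
shrinking the classes: `|g₁| = 1` (Prop. 2.1), `|g₂| = 1`, `g₁` completely multiplicative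
(Prop. 2.2), `g₂` completely multiplicative, and finally `a₁ = a₂` (Theorem 2.3).
[cite: TaoFMP2016, Theorem 1.3 and §2] -/
def Tao2016_theorem13For (P₁ P₂ : ArithmeticFunction ℂ → Prop) : Prop :=
  ∀ (a₁ a₂ b₁ b₂ : ℕ), 1 ≤ a₁ → 1 ≤ a₂ → a₁ * b₂ ≠ a₂ * b₁ → ∀ ε : ℝ, 0 < ε →
    ∃ A₀ : ℝ, ∀ A : ℝ, A₀ ≤ A → ∀ x ω : ℝ, A ≤ ω → ω ≤ x →
      ∀ g₁ g₂ : ArithmeticFunction ℂ, g₁.IsMultiplicative → g₂.IsMultiplicative →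
        (∀ n, ‖g₁ n‖ ≤ 1) → (∀ n, ‖g₂ n‖ ≤ 1) → P₁ g₁ → P₂ g₂ →
        Tao2016_nonpretentiousAt g₁ A x →
        ‖logCorrelation g₁ g₂ a₁ b₁ a₂ b₂ x ω‖ ≤ ε * Real.log ω

/-- `Literature.NumberTheory.LFunctions.tao_log_averaged_elliott_two` (Tao 2016, Thm 1.3) is `Tao2016_theorem13For ⊤ ⊤`.
[cite: TaoFMP2016, Theorem 1.3] -/
theorem tao_log_averaged_elliott_two_iff :
    tao_log_averaged_elliott_two ↔ Tao2016_theorem13For (fun _ => True) (fun _ => True) := by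
  constructor
  · intro h a₁ a₂ b₁ b₂ ha₁ ha₂ hab ε hε
    obtain ⟨A₀, hA⟩ := h a₁ a₂ b₁ b₂ ha₁ ha₂ hab ε hε
    exact ⟨A₀, fun A hA' x ω hω hx g₁ g₂ h1 h2 h3 h4 _ _ h5 =>
      hA A hA' x ω hω hx g₁ g₂ h1 h2 h3 h4 h5⟩
  · intro h a₁ a₂ b₁ b₂ ha₁ ha₂ hab ε hε
    obtain ⟨A₀, hA⟩ := h a₁ a₂ b₁ b₂ ha₁ ha₂ hab ε hε
    exact ⟨A₀, fun A hA' x ω hω hx g₁ g₂ h1 h2 h3 h4 h5 =>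
      hA A hA' x ω hω hx g₁ g₂ h1 h2 h3 h4 trivial trivial h5⟩

/-- Restricting the classes weakens the statement. [folklore] -/
theorem Tao2016_theorem13For.mono {P₁ P₂ P₁' P₂' : ArithmeticFunction ℂ → Prop}
    (h : Tao2016_theorem13For P₁ P₂) (h₁ : ∀ g, P₁' g → P₁ g) (h₂ : ∀ g, P₂' g → P₂ g) :
    Tao2016_theorem13For P₁' P₂' := by
  intro a₁ a₂ b₁ b₂ ha₁ ha₂ hab ε hε
  obtain ⟨A₀, hA⟩ := h a₁ a₂ b₁ b₂ ha₁ ha₂ hab ε hε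
  exact ⟨A₀, fun A hA' x ω hω hx g₁ g₂ m1 m2 b1 b2 p1 p2 hyp =>
    hA A hA' x ω hω hx g₁ g₂ m1 m2 b1 b2 (h₁ _ p1) (h₂ _ p2) hyp⟩

/-- Lowering the level `A' ≤ A` (at a height `x ≥ 0`) weakens hypothesis (1.5). [folklore] -/
theorem Tao2016_nonpretentiousAt.mono {g : ℕ → ℂ} {A A' x : ℝ}
    (h : Tao2016_nonpretentiousAt g A x) (hA' : A' ≤ A) (hx : 0 ≤ x) :
    Tao2016_nonpretentiousAt g A' x := by
  intro q χ t hq hqA htA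
  exact hA'.trans (h q χ t hq (hqA.trans hA') (htA.trans (by gcongr)))

/-! ### The printed reduction steps of §2 as named facts -/

/-- The class of `S¹`-valued completely multiplicative arithmetic functions (the functions of
Tao 2016, Theorem 2.3). [cite: TaoFMP2016, Theorem 2.3] -/
def IsCircleValuedCM (g : ArithmeticFunction ℂ) : Prop :=
  IsCircleValued g ∧ IsCompletelyMultiplicative g

/-- NAMED FACT — **Tao 2016, Proposition 2.1** (Forum Math. Pi 4 (2016) e8, Prop. 2.1, as
printed): "In order to establish Theorem 1.3, it suffices to do so in the special case where
`|g₁(n)| = 1` for all `n`."  (Proof in the paper: factor `g₁ = g'₁ g''₁` with `g'₁ = |g₁|`; if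
`∑_{p ≤ x} (1 - g'₁(p))/p ≥ A₀`, Halász's inequality and Mertens' theorem make the correlation
trivially small; otherwise model `g'₁` by a random `±1`-valued multiplicative function `𝐠'₁`
with `𝔼 𝐠'₁ = g'₁`, apply the unimodular case to `𝐠'₁ g''₁` outside an event of probability
`O(1/A₀)` (Markov), and take expectations.)  Users take `(h : Tao2016_prop21)`.
[cite: TaoFMP2016, Proposition 2.1] -/
def Tao2016_prop21 : Prop :=
  Tao2016_theorem13For IsCircleValued (fun _ => True) → tao_log_averaged_elliott_two

/-- NAMED FACT — **Tao 2016, §2, the sentence following the proof of Proposition 2.1**: "A similar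
argument allows one to also reduce to the case where `|g₂(n)| = 1` for all `n` (indeed, the
argument is slightly simpler as (2.2) is unaffected by changes in `g₂`)."  That is: Theorem 1.3
for `S¹`-valued `g₁, g₂` implies Theorem 1.3 for `S¹`-valued `g₁` and arbitrary `1`-bounded
multiplicative `g₂`.  Users take `(h : Tao2016_prop21_right)`.
[cite: TaoFMP2016, §2 (paragraph after the proof of Proposition 2.1)] -/
def Tao2016_prop21_right : Prop :=
  Tao2016_theorem13For IsCircleValued IsCircleValued →
    Tao2016_theorem13For IsCircleValued (fun _ => True)

/-- NAMED FACT — **Tao 2016, Proposition 2.2** (Forum Math. Pi 4 (2016) e8, Prop. 2.2): "In order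
to establish Theorem 1.3, it suffices to do so in the special case where `|g₁(n)| = |g₂(n)| = 1`
for all `n`, and `g₁` is completely multiplicative."  Its printed proof begins "By the previous
reductions we may already assume that `|g₁(n)| = |g₂(n)| = 1` for all `n`" and shows exactly the
implication recorded here: Theorem 1.3 for (`g₁` completely multiplicative `S¹`-valued, `g₂`
`S¹`-valued) implies Theorem 1.3 for `S¹`-valued `g₁, g₂` (twisted Möbius inversion
`g₁ = g̃₁ * h`, `h(p) = 0`, `|h(p^j)| ≤ 2`; the `d ≤ A₀` terms by the hypothesis after a change of
variables, the `d > A₀` terms by `∑_d |h(d)| d^{-2/3} = O(1)`).  Users take `(h : Tao2016_prop22)`.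
[cite: TaoFMP2016, Proposition 2.2] -/
def Tao2016_prop22 : Prop :=
  Tao2016_theorem13For IsCircleValuedCM IsCircleValued →
    Tao2016_theorem13For IsCircleValued IsCircleValued

/-- NAMED FACT — **Tao 2016, §2, the sentence following the proof of Proposition 2.2**: "A similar
argument allows one to also reduce to the case where `g₂` is completely multiplicative."  That
is: Theorem 1.3 for completely multiplicative `S¹`-valued `g₁, g₂` implies Theorem 1.3 for
`g₁` completely multiplicative `S¹`-valued and `g₂` `S¹`-valued.
Users take `(h : Tao2016_prop22_right)`.
[cite: TaoFMP2016, §2 (paragraph after the proof of Proposition 2.2)] -/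
def Tao2016_prop22_right : Prop :=
  Tao2016_theorem13For IsCircleValuedCM IsCircleValuedCM →
    Tao2016_theorem13For IsCircleValuedCM IsCircleValued

/-! ### The last two reductions of §2, proved -/

/-- `((a n + c : ℤ)).toNat = a n + c` for naturals `a, n, c`. [folklore] -/
private theorem toNat_lin (a n c : ℕ) : ((a : ℤ) * (n : ℤ) + (c : ℤ)).toNat = a * n + c := by
  have : (a : ℤ) * (n : ℤ) + (c : ℤ) = ((a * n + c : ℕ) : ℤ) := by push_cast; ring
  rw [this, Int.toNat_natCast]

/-- `((a n + c + (d - c) : ℤ)).toNat = a n + d` for naturals `a, n, c, d`. [folklore] -/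
private theorem toNat_lin' (a n c d : ℕ) :
    ((a : ℤ) * (n : ℤ) + (c : ℤ) + ((d : ℤ) - (c : ℤ))).toNat = a * n + d := by
  have : (a : ℤ) * (n : ℤ) + (c : ℤ) + ((d : ℤ) - (c : ℤ)) = ((a * n + d : ℕ) : ℤ) := by
    push_cast; ring
  rw [this, Int.toNat_natCast]

/-- `log y ≤ 2√y - 2` for `y > 0` (from `log √y ≤ √y - 1`). [folklore] -/
private theorem log_le_two_sqrt_sub_two {y : ℝ} (hy : 0 < y) :
    Real.log y ≤ 2 * Real.sqrt y - 2 := by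
  have h1 : Real.log (Real.sqrt y) ≤ Real.sqrt y - 1 :=
    Real.log_le_sub_one_of_pos (Real.sqrt_pos.mpr hy)
  rw [Real.log_sqrt hy.le] at h1
  linarith

/-- `log y ≤ y / 2` for `y > 0`. [folklore] -/
private theorem log_le_half {y : ℝ} (hy : 0 < y) : Real.log y ≤ y / 2 := by
  have h1 := log_le_two_sqrt_sub_two hy
  have h3 : Real.sqrt y * Real.sqrt y = y := Real.mul_self_sqrt hy.le
  have h4 : 0 ≤ (Real.sqrt y - 2) * (Real.sqrt y - 2) := mul_self_nonneg _
  have h5 : (Real.sqrt y - 2) * (Real.sqrt y - 2)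
      = Real.sqrt y * Real.sqrt y - 4 * Real.sqrt y + 4 := by ring
  linarith

/-- `1 + log y ≤ (ε/4) y` once `y ≥ (8/ε)²`. [folklore] -/
private theorem one_add_log_le {ε y : ℝ} (hε : 0 < ε) (hy : (8 / ε) ^ 2 ≤ y) :
    1 + Real.log y ≤ ε / 4 * y := by
  have h8 : 0 < 8 / ε := by positivity
  have hypos : 0 < y := lt_of_lt_of_le (by positivity) hy
  have hs : 8 / ε ≤ Real.sqrt y := by
    rw [Real.le_sqrt h8.le hypos.le]
    exact hy
  have hs' : 8 ≤ Real.sqrt y * ε := (div_le_iff₀ hε).mp hs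
  have hss : Real.sqrt y * Real.sqrt y = y := Real.mul_self_sqrt hypos.le
  have hs0 : 0 ≤ Real.sqrt y := Real.sqrt_nonneg y
  have hl := log_le_two_sqrt_sub_two hypos
  have h2 : 2 * Real.sqrt y ≤ ε / 4 * y :=
    calc 2 * Real.sqrt y = (8 / 4) * Real.sqrt y := by norm_num
      _ ≤ (Real.sqrt y * ε / 4) * Real.sqrt y :=
          mul_le_mul_of_nonneg_right (by linarith) hs0
      _ = ε / 4 * (Real.sqrt y * Real.sqrt y) := by ring
      _ = ε / 4 * y := by rw [hss]
  linarith

/-- `√x / 2 ≤ x / log x` for `x > 1`. [folklore] -/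
private theorem sqrt_div_two_le_div_log {x : ℝ} (hx : 1 < x) :
    Real.sqrt x / 2 ≤ x / Real.log x := by
  have hxpos : 0 < x := by linarith
  have hlog : 0 < Real.log x := Real.log_pos hx
  have hsq : Real.sqrt x * Real.sqrt x = x := Real.mul_self_sqrt hxpos.le
  have hl : Real.log x ≤ 2 * Real.sqrt x := by linarith [log_le_two_sqrt_sub_two hxpos]
  rw [le_div_iff₀ hlog]
  calc Real.sqrt x / 2 * Real.log x ≤ Real.sqrt x / 2 * (2 * Real.sqrt x) :=
        mul_le_mul_of_nonneg_left hl (by positivity)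
    _ = Real.sqrt x * Real.sqrt x := by ring
    _ = x := hsq

/-- The level `A' = √A / 2` used below: `A₁ ≤ A' ≤ A` and `A' > 0` once `A ≥ 4 A₁² + 4`.
[folklore] -/
private theorem level_bounds {A A₁ : ℝ} (hA : 4 * A₁ ^ 2 + 4 ≤ A) :
    A₁ ≤ Real.sqrt A / 2 ∧ Real.sqrt A / 2 ≤ A ∧ 0 < Real.sqrt A / 2 ∧ 4 ≤ A := by
  have hA4 : 4 ≤ A := by linarith [sq_nonneg A₁]
  have hApos : 0 ≤ A := by linarith
  have hsqA2 : 2 ≤ Real.sqrt A := by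
    rw [Real.le_sqrt (by norm_num) hApos]
    linarith
  have hsqAA : Real.sqrt A * Real.sqrt A = A := Real.mul_self_sqrt hApos
  refine ⟨?_, ?_, by linarith, hA4⟩
  · have h0 : (2 * A₁) ^ 2 ≤ A := by
      have : (2 * A₁) ^ 2 = 4 * A₁ ^ 2 := by ring
      linarith
    have h1 : |2 * A₁| ≤ Real.sqrt A := Real.abs_le_sqrt h0
    have h2 : 2 * A₁ ≤ Real.sqrt A := (le_abs_self _).trans h1
    linarith
  · have h1 : Real.sqrt A ≤ Real.sqrt A * Real.sqrt A :=
      le_mul_of_one_le_right (by linarith) (by linarith)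
    linarith

/-- A `1`-bounded pair gives summands of norm at most `1/n` in the correlation sum. [folklore] -/
private theorem norm_term_le {g₁ g₂ : ArithmeticFunction ℂ} (hb₁ : ∀ n, ‖g₁ n‖ ≤ 1)
    (hb₂ : ∀ n, ‖g₂ n‖ ≤ 1) (m₁ m₂ n : ℕ) :
    ‖g₁ m₁ * g₂ m₂ / (n : ℂ)‖ ≤ (n : ℝ)⁻¹ := by
  rw [norm_div, norm_mul, Complex.norm_natCast, ← one_div]
  rcases Nat.eq_zero_or_pos n with rfl | hn
  · simp
  · exact div_le_div_of_nonneg_right (mul_le_one₀ (hb₁ _) (norm_nonneg _) (hb₂ _))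
      (Nat.cast_nonneg n)

/-- The harmonic bound `∑_{L < n ≤ ⌊y⌋} 1/n ≤ 1 + log y` for `y ≥ 1`. [folklore] -/
private theorem sum_inv_Ioc_le {y : ℝ} (hy : 1 ≤ y) (L : ℕ) :
    ∑ n ∈ Ioc L ⌊y⌋₊, (n : ℝ)⁻¹ ≤ 1 + Real.log y := by
  have h2 : ∑ n ∈ Icc 1 ⌊y⌋₊, (n : ℝ)⁻¹ ≤ 1 + Real.log y := by
    have := harmonic_floor_le_one_add_log y hy
    simpa only [harmonic_eq_sum_Icc, Rat.cast_sum, Rat.cast_inv, Rat.cast_natCast] using this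
  refine le_trans ?_ h2
  refine Finset.sum_le_sum_of_subset_of_nonneg (fun n hn => ?_) fun n _ _ => by positivity
  rw [Finset.mem_Ioc] at hn
  rw [Finset.mem_Icc]
  omega

/-- **Tao 2016, §2, the two reductions between Proposition 2.2 and Theorem 2.3** (proved):
Theorem 2.3 implies Theorem 1.3 for completely multiplicative `S¹`-valued `g₁, g₂`.  As in the
paper: since `g₁, g₂` are completely multiplicative and `S¹`-valued,
`g₁(a₁n+b₁) g₂(a₂n+b₂) = ḡ₁(a₂) ḡ₂(a₁) g₁(a₁a₂n + a₂b₁) g₂(a₁a₂n + a₁b₂)`, so one may take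
`a₁ = a₂ = a₁a₂` (shifts `a₂b₁ ≠ a₁b₂`); and the range `ω ≤ x` may be strengthened to
`ω ≤ x / log x` because for `x / log x < ω ≤ x` the terms with `n ≤ log x` contribute at most
`∑_{n ≤ log x} 1/n ≤ 1 + log log x`, negligible against `ε log ω ≥ (ε/2) log x` once `A` (hence
`x`) is large.  Theorem 2.3 is invoked at level `√A / 2` (`≤ x / log x` as `x ≥ A`) and with
`ε/2`. [cite: TaoFMP2016, §2 (the two paragraphs preceding Theorem 2.3)] -/
theorem Tao2016_theorem13For_cm_of_theorem23 (h23 : Tao2016_theorem23) :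
    Tao2016_theorem13For IsCircleValuedCM IsCircleValuedCM := by
  intro a₁ a₂ b₁ b₂ ha₁ ha₂ hab ε hε
  have ha : 1 ≤ a₁ * a₂ := Nat.one_le_iff_ne_zero.mpr (Nat.mul_ne_zero (by omega) (by omega))
  have hh : ((a₁ * b₂ : ℕ) : ℤ) - ((a₂ * b₁ : ℕ) : ℤ) ≠ 0 := by
    rw [sub_ne_zero]
    exact_mod_cast hab
  obtain ⟨A₁, hA₁⟩ := h23 (a₁ * a₂) ((a₂ * b₁ : ℕ) : ℤ)
    (((a₁ * b₂ : ℕ) : ℤ) - ((a₂ * b₁ : ℕ) : ℤ)) ha hh (ε / 2) (half_pos hε)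
  refine ⟨max (4 * A₁ ^ 2 + 4) (Real.exp ((8 / ε) ^ 2 + 1)), ?_⟩
  intro A hA x ω hAω hωx g₁ g₂ hg₁ hg₂ hb₁ hb₂ hP₁ hP₂ hhyp
  obtain ⟨hc₁, hm₁⟩ := hP₁
  obtain ⟨hc₂, hm₂⟩ := hP₂
  -- sizes of `A`, `x`, `ω`; the level `A' = √A / 2` at which Theorem 2.3 is invoked
  obtain ⟨hA₁A', hA'A, hA'pos, hA4⟩ := level_bounds ((le_max_left _ _).trans hA)
  set A' : ℝ := Real.sqrt A / 2 with hA'def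
  have hAexp : Real.exp ((8 / ε) ^ 2 + 1) ≤ A := (le_max_right _ _).trans hA
  have hApos : 0 < A := by linarith
  have hxA : A ≤ x := hAω.trans hωx
  have hxpos : 0 < x := by linarith
  have hx1 : 1 < x := by linarith
  have hlogA : (8 / ε) ^ 2 + 1 ≤ Real.log A := by
    rw [← Real.log_exp ((8 / ε) ^ 2 + 1)]
    exact Real.log_le_log (Real.exp_pos _) hAexp
  have hlogxA : Real.log A ≤ Real.log x := Real.log_le_log hApos hxA
  have hε2 : 0 ≤ (8 / ε) ^ 2 := sq_nonneg _
  have hlogx1 : 1 ≤ Real.log x := by linarith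
  have hlogxpos : 0 < Real.log x := by linarith
  have hlogω0 : 0 ≤ Real.log ω := Real.log_nonneg (by linarith)
  have hA'ω : A' ≤ ω := hA'A.trans hAω
  -- `ω₀ = x / log x`
  set ω₀ : ℝ := x / Real.log x with hω₀def
  have hω₀pos : 0 < ω₀ := div_pos hxpos hlogxpos
  have hω₀x : ω₀ ≤ x := div_le_self hxpos.le hlogx1
  have hxω₀ : x / ω₀ = Real.log x := by
    rw [hω₀def, div_div_cancel₀ hxpos.ne']
  have hA'ω₀ : A' ≤ ω₀ := by
    have h1 : Real.sqrt A / 2 ≤ Real.sqrt x / 2 :=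
      div_le_div_of_nonneg_right (Real.sqrt_le_sqrt hxA) (by norm_num)
    exact h1.trans (sqrt_div_two_le_div_log hx1)
  -- Theorem 2.3 at level `A'`, for `a = a₁a₂`, `b = a₂b₁`, `h = a₁b₂ - a₂b₁`, tolerance `ε/2`
  have key : ∀ ω' : ℝ, A' ≤ ω' → ω' ≤ x / Real.log x → ω' ≤ x →
      ‖∑ n ∈ Ioc ⌊x / ω'⌋₊ ⌊x⌋₊,
          g₁ (a₁ * a₂ * n + a₂ * b₁) * g₂ (a₁ * a₂ * n + a₁ * b₂) / (n : ℂ)‖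
        ≤ ε / 2 * Real.log ω' := by
    intro ω' h1 h2 h3
    have := hA₁ A' hA₁A' x ω' h1 h2 h3 g₁ g₂
      (fun m n _ _ => hm₁ m n) (fun m n _ _ => hm₂ m n)
      (fun n hn => hc₁ n (Nat.one_le_iff_ne_zero.mp hn))
      (fun n hn => hc₂ n (Nat.one_le_iff_ne_zero.mp hn))
      (hhyp.mono hA'A hxpos.le)
    simpa only [toNat_lin, toNat_lin'] using this
  -- rescaling `(a₁, a₂, b₁, b₂) ↦ (a₁a₂, a₁a₂, a₂b₁, a₁b₂)`
  have resc : (g₁ a₂ * g₂ a₁) * logCorrelation g₁ g₂ a₁ b₁ a₂ b₂ x ω =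
      ∑ n ∈ Ioc ⌊x / ω⌋₊ ⌊x⌋₊,
        g₁ (a₁ * a₂ * n + a₂ * b₁) * g₂ (a₁ * a₂ * n + a₁ * b₂) / (n : ℂ) := by
    unfold logCorrelation
    rw [Finset.mul_sum]
    refine Finset.sum_congr rfl fun n _ => ?_
    rw [show a₁ * a₂ * n + a₂ * b₁ = a₂ * (a₁ * n + b₁) by ring,
      show a₁ * a₂ * n + a₁ * b₂ = a₁ * (a₂ * n + b₂) by ring, hm₁, hm₂]
    ring
  have hnorm : ‖logCorrelation g₁ g₂ a₁ b₁ a₂ b₂ x ω‖ =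
      ‖∑ n ∈ Ioc ⌊x / ω⌋₊ ⌊x⌋₊,
        g₁ (a₁ * a₂ * n + a₂ * b₁) * g₂ (a₁ * a₂ * n + a₁ * b₂) / (n : ℂ)‖ := by
    rw [← resc, norm_mul, norm_mul, hc₁ a₂ (by omega), hc₂ a₁ (by omega), one_mul, one_mul]
  rw [hnorm]
  rcases le_or_gt ω ω₀ with hle | hlt
  · -- `ω ≤ x / log x`: Theorem 2.3 applies directly
    have h1 := key ω hA'ω hle hωx
    linarith [mul_nonneg hε.le hlogω0]
  · -- `x / log x < ω ≤ x`: split off the terms with `n ≤ log x`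
    have hL : ⌊x / ω⌋₊ ≤ ⌊x / ω₀⌋₊ :=
      Nat.floor_le_floor (div_le_div_of_nonneg_left hxpos.le hω₀pos hlt.le)
    have hU : ⌊x / ω₀⌋₊ ≤ ⌊x⌋₊ := by
      refine Nat.floor_le_floor ?_
      rw [hxω₀]
      linarith [Real.log_le_sub_one_of_pos hxpos]
    rw [← Finset.sum_Ioc_consecutive _ hL hU]
    have hmain : ‖∑ n ∈ Ioc ⌊x / ω₀⌋₊ ⌊x⌋₊,
        g₁ (a₁ * a₂ * n + a₂ * b₁) * g₂ (a₁ * a₂ * n + a₁ * b₂) / (n : ℂ)‖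
          ≤ ε / 2 * Real.log ω := by
      refine (key ω₀ hA'ω₀ le_rfl hω₀x).trans ?_
      exact mul_le_mul_of_nonneg_left (Real.log_le_log hω₀pos hlt.le) (by positivity)
    have hsmall : ‖∑ n ∈ Ioc ⌊x / ω⌋₊ ⌊x / ω₀⌋₊,
        g₁ (a₁ * a₂ * n + a₂ * b₁) * g₂ (a₁ * a₂ * n + a₁ * b₂) / (n : ℂ)‖
          ≤ ε / 2 * Real.log ω := by
      -- `≤ ∑_{n ≤ log x} 1/n ≤ 1 + log log x`
      have h1 : ‖∑ n ∈ Ioc ⌊x / ω⌋₊ ⌊x / ω₀⌋₊,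
          g₁ (a₁ * a₂ * n + a₂ * b₁) * g₂ (a₁ * a₂ * n + a₁ * b₂) / (n : ℂ)‖
            ≤ 1 + Real.log (Real.log x) := by
        refine (norm_sum_le _ _).trans ?_
        refine (Finset.sum_le_sum fun n _ => norm_term_le hb₁ hb₂ _ _ n).trans ?_
        rw [hxω₀]
        exact sum_inv_Ioc_le hlogx1 _
      -- `1 + log log x ≤ (ε/4) log x ≤ (ε/2) log ω`
      have h3 : Real.log x / 2 ≤ Real.log ω := by
        have hω₀ω := Real.log_le_log hω₀pos hlt.le
        have : Real.log ω₀ = Real.log x - Real.log (Real.log x) := by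
          rw [hω₀def, Real.log_div hxpos.ne' hlogxpos.ne']
        linarith [log_le_half hlogxpos]
      have h4 : 1 + Real.log (Real.log x) ≤ ε / 4 * Real.log x :=
        one_add_log_le hε (by linarith)
      have h5 : ε / 4 * Real.log x ≤ ε / 2 * Real.log ω := by
        have := mul_le_mul_of_nonneg_left h3 hε.le
        linarith
      linarith
    calc _ ≤ _ := norm_add_le _ _
      _ ≤ ε / 2 * Real.log ω + ε / 2 * Real.log ω := add_le_add hsmall hmain
      _ = ε * Real.log ω := by ring

/-! ### Assembly -/

/-- **§2 assembled** (Tao 2016, §2: "Putting all these reductions together, we see that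
Theorem 1.3 will be a consequence of [Theorem 2.3]"): the four printed reduction steps
(Prop. 2.1, its `g₂`-analogue, Prop. 2.2, its `g₂`-analogue) and the proved rescaling /
`ω ≤ x / log x` step give the §2 reduction `Literature.NumberTheory.LFunctions.Tao2016_section2_reduction`
(`Tao2016_theorem23 → tao_log_averaged_elliott_two`).
[cite: TaoFMP2016, §2 (paragraph before Theorem 2.3)] -/
theorem Tao2016_section2_reduction_of_props (h21 : Tao2016_prop21)
    (h21r : Tao2016_prop21_right) (h22 : Tao2016_prop22) (h22r : Tao2016_prop22_right) :
    Tao2016_section2_reduction :=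
  fun h23 => h21 (h21r (h22 (h22r (Tao2016_theorem13For_cm_of_theorem23 h23))))

/-- **Theorem 1.3 from its parts** (Tao 2016, §2): Propositions 2.1, 2.2 (with their
`g₂`-analogues) and Theorem 2.3 imply `Literature.NumberTheory.LFunctions.tao_log_averaged_elliott_two`.
[cite: TaoFMP2016, §2] -/
theorem tao_log_averaged_elliott_two_of_props (h21 : Tao2016_prop21)
    (h21r : Tao2016_prop21_right) (h22 : Tao2016_prop22) (h22r : Tao2016_prop22_right)
    (h23 : Tao2016_theorem23) : tao_log_averaged_elliott_two :=
  Tao2016_section2_reduction_of_props h21 h21r h22 h22r h23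

end Literature.NumberTheory.LFunctions
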